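import Summits.MatrixMultiplication.OmegaCensus.SmallFormats.MatMul22nRankOneShapes
import HarnessLib

/-!
# ω-census family (a): the GRAM BLOCK of a row cheap plane against a column cheap plane — non-degeneracy bookkeeping (any field)

Cell `pub-omega` (unit `pub-omega-tensor`, gen 40), topic `Summits/MatrixMultiplication/OmegaCensus` (sub-folder
`SmallFormats`). Framing (verbatim): lottery ticket; floor = certified bounds/negative ranges. HONEST FRAMING: linear-algebra plumbing for
§7 of memo DEFLATION-g40 (the M2 kill). For a row cheap plane `span(c 0, c 1) ⊆ kⁿ` and a column cheap plane `span(b 0, b 1)` the GRAM BLOCK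
is `P l m := c l ⬝ᵥ b m`. This file: (i) the cheap-input value of a term whose Y-form rows lie in `span(c)` is a `P`-image
(`g_cheapInput_eq_vecMul`); (ii) if two such image pairs admit no non-trivial vanishing combination (the conclusion of
`ColumnSubcomp.double_cell_independent`, p736887) then `det P ≠ 0` (`det_ne_zero_of_independent_images`); (iii) `det P ≠ 0` gives the
non-degeneracy hypotheses consumed by `RankOneShapes.combo_eq_zero_of_nondeg` (p737081) on both sides (`c_combo_eq_zero_of_perp`,
`b_combo_eq_zero_of_perp`). Imports `MatMul22nRankOneShapes` (p737081) for the `k²` helper. Nothing here is a bound on `ω`.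
-/

namespace Summit.MatrixMultiplication.OmegaCensus.SmallFormats

open Finset Module Matrix
open Literature.Computability.AlgebraicComplexity

namespace GramNondeg

variable {k : Type*} [Field k] {n : ℕ} {ι : Type*} [Fintype ι]

omit [Fintype ι] in
/-- In `k²`: two vectors orthogonal to a non-zero `q` admit a non-trivial vanishing combination. -/
theorem exists_combo_of_perp (q u₁ u₂ : Fin 2 → k) (hq : q ≠ 0) (h₁ : u₁ ⬝ᵥ q = 0) (h₂ : u₂ ⬝ᵥ q = 0) :
    ∃ a₁ a₂ : k, (a₁ ≠ 0 ∨ a₂ ≠ 0) ∧ ∀ m, a₁ * u₁ m + a₂ * u₂ m = 0 := by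
  by_cases hu : u₁ = 0
  · exact ⟨1, 0, Or.inl one_ne_zero, fun m => by simp [hu]⟩
  have hq' : q 0 ≠ 0 ∨ q 1 ≠ 0 := by
    by_contra h; push Not at h; apply hq; funext i; fin_cases i <;> simp [h.1, h.2]
  have hu' : u₁ 0 ≠ 0 ∨ u₁ 1 ≠ 0 := by
    by_contra h; push Not at h; apply hu; funext i; fin_cases i <;> simp [h.1, h.2]
  simp only [dotProduct, Fin.sum_univ_two] at h₁ h₂
  obtain ⟨η, e0, e1⟩ := RankOneShapes.prop_of_perp₂ (q 0) (q 1) (u₂ 0) (u₂ 1) (u₁ 0) (u₁ 1) hq' h₂ h₁ hu'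
  refine ⟨η, -1, Or.inr (by norm_num), fun m => ?_⟩
  fin_cases m
  · simp [e0]
  · simp [e1]

/-- The Gram block of `c` against `b`: `P l m = c l ⬝ᵥ b m`. -/
theorem gram_apply (c b : Fin 2 → (Fin n → k)) (l m : Fin 2) :
    (Matrix.of fun l m => c l ⬝ᵥ b m : Matrix (Fin 2) (Fin 2) k) l m = c l ⬝ᵥ b m := rfl

omit [Fintype ι] in
/-- A `c`-combination paired with `b m` is a `P`-image: `(∑ a l • c l) ⬝ᵥ b m = (a ᵥ* P) m`. -/
theorem combo_dotProduct_eq_vecMul (c b : Fin 2 → (Fin n → k)) (a : Fin 2 → k) (m : Fin 2) :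
    (∑ l, a l • c l) ⬝ᵥ b m = Matrix.vecMul a (Matrix.of fun l m => c l ⬝ᵥ b m) m := by
  rw [sum_dotProduct]
  simp only [Matrix.vecMul, dotProduct, Matrix.of_apply, Pi.smul_apply, smul_eq_mul, Finset.mul_sum, mul_assoc]

omit [Fintype ι] in
/-- Dually: `c l ⬝ᵥ (∑ a m • b m) = (P *ᵥ a) l`. -/
theorem dotProduct_combo_eq_mulVec (c b : Fin 2 → (Fin n → k)) (a : Fin 2 → k) (l : Fin 2) :
    c l ⬝ᵥ (∑ m, a m • b m) = Matrix.mulVec (Matrix.of fun l m => c l ⬝ᵥ b m) a l := by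
  rw [dotProduct_sum]
  simp only [Matrix.mulVec, dotProduct, Matrix.of_apply, Pi.smul_apply, smul_eq_mul, Finset.sum_mul]
  exact Finset.sum_congr rfl fun m _ => Finset.sum_congr rfl fun i _ => by ring

/-- **The cheap-input value of a term with Y-form rows in `span(c)` is a `P`-image**: if row `κ` of `G_t` is `∑_l A κ l • c l` then
`g_t(ν (b m)ᵀ) = ((ν ᵥ* A) ᵥ* P) m`. -/
theorem g_cheapInput_eq_vecMul (β : BilinComp (mulBilin k 2 2 n) ι) (t : ι) (c b : Fin 2 → (Fin n → k)) (ν : Fin 2 → k)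
    (A : Matrix (Fin 2) (Fin 2) k) (hrows : ∀ κ : Fin 2, (fun j => β.g t (Matrix.single κ j (1 : k))) = ∑ l, A κ l • c l) (m : Fin 2) :
    β.g t (Matrix.vecMulVec ν (b m)) = Matrix.vecMul (Matrix.vecMul ν A) (Matrix.of fun l m => c l ⬝ᵥ b m) m := by
  rw [CheapSpans.g_vecMulVec_eq_sum]
  -- ∑_i b m i * (ν ᵥ* Garr) i = (∑_κ ν κ • row κ) ⬝ᵥ b m
  have hG : (Matrix.of fun μ' j => β.g t (Matrix.single μ' j (1 : k)) : Matrix (Fin 2) (Fin n) k) =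
      Matrix.of fun μ' j => (∑ l, A μ' l • c l) j := by
    ext μ' j
    rw [Matrix.of_apply, Matrix.of_apply, ← hrows μ']
  rw [hG]
  have h1 : ∀ i, Matrix.vecMul ν (Matrix.of fun μ' j => (∑ l, A μ' l • c l) j) i = (∑ l, (Matrix.vecMul ν A) l • c l) i := by
    intro i
    simp only [Matrix.vecMul, dotProduct, Matrix.of_apply, Finset.sum_apply, Pi.smul_apply, smul_eq_mul, Finset.mul_sum,
      Finset.sum_mul]
    rw [Finset.sum_comm]
    exact Finset.sum_congr rfl fun l _ => Finset.sum_congr rfl fun κ _ => by ring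
  simp_rw [h1]
  rw [← combo_dotProduct_eq_vecMul, dotProduct]
  exact Finset.sum_congr rfl fun i _ => mul_comm _ _

omit [Fintype ι] in
/-- **Independent image pairs force an invertible Gram block.** If two `P`-images `w₁ ᵥ* P`, `w₂ ᵥ* P` admit no non-trivial vanishing
combination, then `det P ≠ 0`. -/
theorem det_ne_zero_of_independent_images (P : Matrix (Fin 2) (Fin 2) k) (w₁ w₂ : Fin 2 → k)
    (hind : ∀ a₁ a₂ : k, (∀ m, a₁ * Matrix.vecMul w₁ P m + a₂ * Matrix.vecMul w₂ P m = 0) → a₁ = 0 ∧ a₂ = 0) : P.det ≠ 0 := by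
  intro hdet
  obtain ⟨q, hq, hPq⟩ := Matrix.exists_mulVec_eq_zero_iff.mpr hdet
  have h₁ : Matrix.vecMul w₁ P ⬝ᵥ q = 0 := by rw [← Matrix.dotProduct_mulVec, hPq, dotProduct_zero]
  have h₂ : Matrix.vecMul w₂ P ⬝ᵥ q = 0 := by rw [← Matrix.dotProduct_mulVec, hPq, dotProduct_zero]
  obtain ⟨a₁, a₂, hne, hrel⟩ := exists_combo_of_perp q _ _ hq h₁ h₂
  obtain ⟨e₁, e₂⟩ := hind a₁ a₂ hrel
  rcases hne with h | h
  · exact h e₁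
  · exact h e₂

omit [Fintype ι] in
/-- **Non-degeneracy on the `c` side**: `det P ≠ 0` and a `c`-combination orthogonal to both `b m` ⇒ the combination vanishes. -/
theorem c_combo_eq_zero_of_perp (c b : Fin 2 → (Fin n → k)) (hdet : (Matrix.of fun l m => c l ⬝ᵥ b m : Matrix (Fin 2) (Fin 2) k).det ≠ 0)
    (a : Fin 2 → k) (h : ∀ m, (∑ l, a l • c l) ⬝ᵥ b m = 0) : ∑ l, a l • c l = 0 := by
  have ha : Matrix.vecMul a (Matrix.of fun l m => c l ⬝ᵥ b m) = 0 := by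
    funext m; rw [← combo_dotProduct_eq_vecMul, h m, Pi.zero_apply]
  have ha0 : a = 0 := Matrix.eq_zero_of_vecMul_eq_zero hdet ha
  simp [ha0]

omit [Fintype ι] in
/-- **Non-degeneracy on the `b` side**: `det P ≠ 0` and a `b`-combination orthogonal to both `c l` ⇒ the combination vanishes. -/
theorem b_combo_eq_zero_of_perp (c b : Fin 2 → (Fin n → k)) (hdet : (Matrix.of fun l m => c l ⬝ᵥ b m : Matrix (Fin 2) (Fin 2) k).det ≠ 0)
    (a : Fin 2 → k) (h : ∀ l, c l ⬝ᵥ (∑ m, a m • b m) = 0) : ∑ m, a m • b m = 0 := by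
  have ha : Matrix.mulVec (Matrix.of fun l m => c l ⬝ᵥ b m) a = 0 := by
    funext l; rw [← dotProduct_combo_eq_mulVec, h l, Pi.zero_apply]
  have ha0 : a = 0 := Matrix.eq_zero_of_mulVec_eq_zero hdet ha
  simp [ha0]

end GramNondeg

end Summit.MatrixMultiplication.OmegaCensus.SmallFormats
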